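import Mathlib.LinearAlgebra.CrossProduct
import Literature.Analysis.FluidPDE.SteadyNSLatticePersistence

/-!
# Craya frames of the Fourier lattice `ℤ³`: integer frames, unit frames, the Leray multiplier in
# frame coordinates
(instab3 g5 — implementation 1 of the skew-cut X0 certifier, cell `ns-blowup`, 2026-08-26)

HONEST FRAMING (human ruling D-0035): nothing here is a claim about Navier–Stokes blow-up.
WHAT THIS IS NOT: not NS evidence. MODEL lane bookkeeping: these are the COORDINATES in which
implementation 1 (`HOME/instab3/code/i3core.py`, `i3exact.py`; INSTAB3-METHOD §2, §4) assembles the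
Galerkin matrices of the linearised operator about the ABC flow, written so that the abstract X0
chain (`SkewCutGalerkinFromSections.exists_smooth_eigenvector_Ioo_of_sections'`, index type `ι`,
Hilbert basis `b`) can be instantiated on `ℓ²` of the Craya index set and its output handed to the
Cartesian synthesis door `AbcLinearisedLattice.isLinNSEigenvalue_abcFlow_of_crossForm`
(KERNEL-CHAIN.md of HOME/instab4, residue (i) COORDINATES of INSTAB3-METHOD §11).

* §1 **Integer Craya frames** (INSTAB3-METHOD §4, the certifier's exact integer data):
  `E₁(k) = (−k₁, k₀, 0)` and `E₂(k) = k × E₁(k) = (−k₂k₀, −k₂k₁, k₀² + k₁²)` off the polar axis,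
  and on the polar axis `k = (0, 0, k₂)`: `E₁ = (sign k₂, 0, 0)`, `E₂ = k × E₁ = (0, |k₂|, 0)`
  (`crayaFst`, `crayaInt 0 = E₁`, `crayaInt 1 = k × E₁`). Both are orthogonal to `k` and to each
  other, `|E₂|² = |k|²|E₁|²`, `E₁(k) = 0 ↔ k = 0`; parity `E₁(−k) = −E₁(k)`, `E₂(−k) = E₂(k)`.
* §2 **Unit frames** `e_a(k) = E_a(k)/|E_a(k)| ∈ ℂ³` (`crayaVec`, real vectors; `e_a(0) = 0`):
  for `k ≠ 0` an orthonormal pair spanning `k^⊥`, and for EVERY `k` and every `X ∈ ℂ³` the Leray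
  multiplier is `Π_k X = ∑_a ⟪e_a(k), X⟫ e_a(k)` (`lerayCoeff_eq_sum_inner_crayaVec`).
* The coordinate maps (scalar families on `{k ≠ 0} × Fin 2` ↔ transversal vector families) and
  the certifier's scalar matrix are in the sequel files `CrayaCoordinates`, `AbcCrayaMatrix`.

Design: the polar-axis convention is the certifier's (INSTAB3-METHOD §4; implementation 2 uses a helical
frame). Mathlib + Literature only. New definitions (review lane): `crayaFst`, `crayaInt`, `crayaLen`, `crayaVec`.
-/

noncomputable section

open scoped BigOperators InnerProductSpace ComplexConjugate Matrix
open Finset Matrix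

namespace Summit.NavierStokesRegularity.FluidComputer.CrayaFrames

open Literature.Analysis.FluidPDE Literature.Analysis.FluidPDE.SteadyLattice
open Literature.Analysis.FunctionSpaces Literature.Analysis.FunctionSpaces.Torus

/-! ### §1 Integer Craya frames -/

/-- The first INTEGER Craya vector of a lattice frequency `k` (INSTAB3-METHOD §4):
`E₁(k) = (−k₁, k₀, 0)` if `(k₀, k₁) ≠ (0, 0)`, and on the polar axis `E₁(0,0,k₂) = (sign k₂, 0, 0)`
(so `E₁(0) = 0`). -/
def crayaFst (k : Fin 3 → ℤ) : Fin 3 → ℤ :=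
  if k 0 = 0 ∧ k 1 = 0 then ![Int.sign (k 2), 0, 0] else ![-k 1, k 0, 0]

/-- The two INTEGER Craya vectors: `crayaInt 0 k = E₁(k)` and `crayaInt 1 k = E₂(k) := k × E₁(k)`
(`= (−k₂k₀, −k₂k₁, k₀² + k₁²)` off the polar axis, `(0, |k₂|, 0)` on it; INSTAB3-METHOD §4). -/
def crayaInt (a : Fin 2) (k : Fin 3 → ℤ) : Fin 3 → ℤ :=
  if a = 0 then crayaFst k else k ⨯₃ crayaFst k

/-- `crayaInt 0 = E₁`. -/
theorem crayaInt_zero (k : Fin 3 → ℤ) : crayaInt 0 k = crayaFst k := by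
  simp [crayaInt]

/-- `crayaInt 1 = E₂ = k × E₁`. -/
theorem crayaInt_one (k : Fin 3 → ℤ) : crayaInt 1 k = k ⨯₃ crayaFst k := by
  simp [crayaInt]

/-- The first frame vector on the polar axis. -/
theorem crayaFst_of_polar {k : Fin 3 → ℤ} (h : k 0 = 0 ∧ k 1 = 0) :
    crayaFst k = ![Int.sign (k 2), 0, 0] := by
  rw [crayaFst, if_pos h]

/-- The first frame vector off the polar axis. -/
theorem crayaFst_of_not_polar {k : Fin 3 → ℤ} (h : ¬(k 0 = 0 ∧ k 1 = 0)) :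
    crayaFst k = ![-k 1, k 0, 0] := by
  rw [crayaFst, if_neg h]

/-- `k · E₁(k) = 0`. -/
theorem dotProduct_self_crayaFst (k : Fin 3 → ℤ) : k ⬝ᵥ crayaFst k = 0 := by
  by_cases h : k 0 = 0 ∧ k 1 = 0
  · rw [crayaFst_of_polar h, vec3_dotProduct]
    simp [h.1, h.2]
  · rw [crayaFst_of_not_polar h, vec3_dotProduct]
    simp; ring

/-- `k · E_a(k) = 0` for both frame vectors. -/
theorem dotProduct_self_crayaInt (a : Fin 2) (k : Fin 3 → ℤ) : k ⬝ᵥ crayaInt a k = 0 := by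
  fin_cases a
  · simpa [crayaInt] using dotProduct_self_crayaFst k
  · simp [crayaInt, dot_self_cross]

/-- `E₁(k) · E₂(k) = 0`. -/
theorem dotProduct_crayaInt_zero_one (k : Fin 3 → ℤ) : crayaInt 0 k ⬝ᵥ crayaInt 1 k = 0 := by
  rw [crayaInt_zero, crayaInt_one, dot_cross_self]

/-- Lagrange: `|E₂(k)|² = |k|² |E₁(k)|²` (as integer dot products). -/
theorem dotProduct_crayaInt_one_self (k : Fin 3 → ℤ) :
    crayaInt 1 k ⬝ᵥ crayaInt 1 k = (k ⬝ᵥ k) * (crayaFst k ⬝ᵥ crayaFst k) := by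
  rw [crayaInt_one, cross_dot_cross, dotProduct_self_crayaFst, dotProduct_comm (crayaFst k) k,
    dotProduct_self_crayaFst, mul_zero, sub_zero]

/-- `|E₁(k)|²` is `k₀² + k₁²` off the polar axis and `(sign k₂)²` on it. -/
theorem dotProduct_crayaFst_self (k : Fin 3 → ℤ) :
    crayaFst k ⬝ᵥ crayaFst k = if k 0 = 0 ∧ k 1 = 0 then Int.sign (k 2) * Int.sign (k 2)
      else k 0 * k 0 + k 1 * k 1 := by
  by_cases h : k 0 = 0 ∧ k 1 = 0
  · rw [crayaFst_of_polar h, if_pos h, vec3_dotProduct]; simp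
  · rw [crayaFst_of_not_polar h, if_neg h, vec3_dotProduct]; simp; ring

/-- `E₁(k) = 0` exactly for `k = 0`. -/
theorem crayaFst_eq_zero_iff (k : Fin 3 → ℤ) : crayaFst k = 0 ↔ k = 0 := by
  constructor
  · intro h0
    by_cases h : k 0 = 0 ∧ k 1 = 0
    · rw [crayaFst_of_polar h] at h0
      have h2 : Int.sign (k 2) = 0 := by
        have := congr_fun h0 0
        simpa using this
      have hk2 : k 2 = 0 := Int.sign_eq_zero_iff_zero.mp h2
      funext i
      fin_cases i
      · exact h.1
      · exact h.2
      · exact hk2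
    · rw [crayaFst_of_not_polar h] at h0
      have h0' : k 0 = 0 := by have := congr_fun h0 1; simpa using this
      have h1' : k 1 = 0 := by have := congr_fun h0 0; simpa using this
      exact absurd ⟨h0', h1'⟩ h
  · rintro rfl
    rw [crayaFst_of_polar ⟨rfl, rfl⟩]
    simp

/-- `|m|² > 0` for a non-zero integer vector `m` (integer dot product). -/
theorem dotProduct_self_pos {m : Fin 3 → ℤ} (hm : m ≠ 0) : 0 < m ⬝ᵥ m := by
  rw [vec3_dotProduct]
  have h3 : ¬(m 0 = 0 ∧ m 1 = 0 ∧ m 2 = 0) := by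
    intro h
    apply hm
    funext i
    fin_cases i
    · exact h.1
    · exact h.2.1
    · exact h.2.2
  by_contra hle
  push Not at hle
  apply h3
  refine ⟨?_, ?_, ?_⟩ <;> nlinarith [mul_self_nonneg (m 0), mul_self_nonneg (m 1), mul_self_nonneg (m 2)]

/-- `|E₁(k)|² > 0` for `k ≠ 0` (integer dot product). -/
theorem dotProduct_crayaFst_self_pos {k : Fin 3 → ℤ} (hk : k ≠ 0) : 0 < crayaFst k ⬝ᵥ crayaFst k :=
  dotProduct_self_pos fun h => hk ((crayaFst_eq_zero_iff k).mp h)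

/-- `|E_a(k)|² > 0` for `k ≠ 0`, both frame vectors. -/
theorem dotProduct_crayaInt_self_pos {k : Fin 3 → ℤ} (hk : k ≠ 0) (a : Fin 2) :
    0 < crayaInt a k ⬝ᵥ crayaInt a k := by
  fin_cases a
  · simpa [crayaInt] using dotProduct_crayaFst_self_pos hk
  · simpa [dotProduct_crayaInt_one_self] using
      mul_pos (dotProduct_self_pos hk) (dotProduct_crayaFst_self_pos hk)

/-- The frame vectors of a non-zero frequency are non-zero. -/
theorem crayaInt_ne_zero {k : Fin 3 → ℤ} (hk : k ≠ 0) (a : Fin 2) : crayaInt a k ≠ 0 := by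
  intro h
  have := dotProduct_crayaInt_self_pos hk a
  rw [h, dotProduct_zero] at this
  exact lt_irrefl _ this

/-- `E_a(0) = 0`. -/
theorem crayaInt_zero_freq (a : Fin 2) : crayaInt a 0 = 0 := by
  have h0 : crayaFst 0 = 0 := (crayaFst_eq_zero_iff 0).mpr rfl
  fin_cases a
  · simpa [crayaInt] using h0
  · simp [crayaInt, h0]

/-- Parity of the first frame vector: `E₁(−k) = −E₁(k)`. -/
theorem crayaFst_neg (k : Fin 3 → ℤ) : crayaFst (-k) = -crayaFst k := by
  by_cases h : k 0 = 0 ∧ k 1 = 0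
  · have h' : (-k) 0 = 0 ∧ (-k) 1 = 0 := by simp [h.1, h.2]
    rw [crayaFst_of_polar h, crayaFst_of_polar h']
    funext i; fin_cases i <;> simp [Int.sign_neg]
  · have h' : ¬((-k) 0 = 0 ∧ (-k) 1 = 0) := by simpa using h
    rw [crayaFst_of_not_polar h, crayaFst_of_not_polar h']
    funext i; fin_cases i <;> simp

/-- Parity of the frame: `E₁(−k) = −E₁(k)`, `E₂(−k) = E₂(k)`. -/
theorem crayaInt_neg (a : Fin 2) (k : Fin 3 → ℤ) :
    crayaInt a (-k) = if a = 0 then -crayaInt a k else crayaInt a k := by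
  fin_cases a
  · simp [crayaInt, crayaFst_neg]
  · simp [crayaInt, crayaFst_neg, map_neg, LinearMap.neg_apply]

/-! ### §2 Unit frames and the Leray multiplier in frame coordinates -/

/-- `|m|² = m · m`: the real squared length of an integer vector is the cast of its integer dot
square. -/
theorem freqNormSq_eq_cast_dotProduct (m : Fin 3 → ℤ) : freqNormSq m = ((m ⬝ᵥ m : ℤ) : ℝ) := by
  simp only [freqNormSq, dotProduct, sq]
  push_cast
  rfl

/-- The length `|E_a(k)|` of an integer Craya vector (`d₁ = ρ̃ = √(k₀²+k₁²)` off the polar axis and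
`1` on it; `d₂ = ρ̃|k|`; INSTAB3-METHOD §4). -/
def crayaLen (a : Fin 2) (k : Fin 3 → ℤ) : ℝ := Real.sqrt (freqNormSq (crayaInt a k))

/-- `|E_a(k)|²` is the squared length of the integer frame vector. -/
theorem crayaLen_sq (a : Fin 2) (k : Fin 3 → ℤ) : crayaLen a k ^ 2 = freqNormSq (crayaInt a k) :=
  Real.sq_sqrt (freqNormSq_nonneg _)

/-- `|E_a(k)| ≥ 0`. -/
theorem crayaLen_nonneg (a : Fin 2) (k : Fin 3 → ℤ) : 0 ≤ crayaLen a k := Real.sqrt_nonneg _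

/-- `|E_a(k)| > 0` for `k ≠ 0`. -/
theorem crayaLen_pos {k : Fin 3 → ℤ} (hk : k ≠ 0) (a : Fin 2) : 0 < crayaLen a k := by
  rw [crayaLen, Real.sqrt_pos, freqNormSq_eq_cast_dotProduct]
  exact_mod_cast dotProduct_crayaInt_self_pos hk a

/-- `|E_a(0)| = 0`. -/
theorem crayaLen_zero_freq (a : Fin 2) : crayaLen a 0 = 0 := by
  rw [crayaLen, crayaInt_zero_freq]
  simp [freqNormSq]

/-- `|E₂(k)| = |k| · |E₁(k)|` (`d₂ = ρ̃|k|`, INSTAB3-METHOD §4). -/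
theorem crayaLen_one (k : Fin 3 → ℤ) : crayaLen 1 k = Real.sqrt (freqNormSq k) * crayaLen 0 k := by
  rw [crayaLen, crayaLen, ← Real.sqrt_mul (freqNormSq_nonneg k), freqNormSq_eq_cast_dotProduct,
    freqNormSq_eq_cast_dotProduct, freqNormSq_eq_cast_dotProduct, dotProduct_crayaInt_one_self,
    crayaInt_zero]
  push_cast
  ring_nf

/-- **The unit Craya frame** `e_a(k) = E_a(k)/|E_a(k)|` as a (real) vector of `ℂ³`; by convention
`e_a(0) = 0`. This is the basis `e₁, e₂` of `k^⊥` of INSTAB3-METHOD §2/§4 (`φ_{k,b} = e_b(k)e^{ik·x}`). -/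
def crayaVec (a : Fin 2) (k : Fin 3 → ℤ) : EuclideanSpace ℂ (Fin 3) :=
  (((crayaLen a k)⁻¹ : ℝ) : ℂ) • Torus.freqVec (crayaInt a k)

/-- Components of the unit frame: `(e_a(k))_j = |E_a(k)|⁻¹ (E_a(k))_j`. -/
theorem crayaVec_apply (a : Fin 2) (k : Fin 3 → ℤ) (j : Fin 3) :
    crayaVec a k j = (((crayaLen a k)⁻¹ : ℝ) : ℂ) * ((crayaInt a k j : ℤ) : ℂ) := by
  simp [crayaVec, Torus.freqVec_apply]

/-- `e_a(0) = 0` (convention). -/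
theorem crayaVec_zero_freq (a : Fin 2) : crayaVec a 0 = 0 := by
  simp [crayaVec, crayaLen_zero_freq]

/-- The frame vectors are real: `conj (e_a(k))_j = (e_a(k))_j`. -/
theorem conj_crayaVec_apply (a : Fin 2) (k : Fin 3 → ℤ) (j : Fin 3) :
    conj (crayaVec a k j) = crayaVec a k j := by
  rw [crayaVec_apply, map_mul, Complex.conj_ofReal, map_intCast]

/-- Inner products against a frame vector are bilinear pairings (reality):
`⟪e_a(k), X⟫ = ∑ⱼ (e_a(k))ⱼ Xⱼ = |E_a(k)|⁻¹ ∑ⱼ (E_a(k))ⱼ Xⱼ`. -/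
theorem inner_crayaVec_left (a : Fin 2) (k : Fin 3 → ℤ) (X : EuclideanSpace ℂ (Fin 3)) :
    ⟪crayaVec a k, X⟫_ℂ = (((crayaLen a k)⁻¹ : ℝ) : ℂ) * ∑ j, ((crayaInt a k j : ℤ) : ℂ) * X j := by
  rw [PiLp.inner_apply, Finset.mul_sum]
  refine Finset.sum_congr rfl fun j _ => ?_
  rw [RCLike.inner_apply, conj_crayaVec_apply, crayaVec_apply]
  ring

/-- The frame vectors are transversal: `k · e_a(k) = 0`. -/
theorem kdot_crayaVec (a : Fin 2) (k : Fin 3 → ℤ) : ∑ j, ((k j : ℤ) : ℂ) * crayaVec a k j = 0 := by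
  have h : ((k ⬝ᵥ crayaInt a k : ℤ) : ℂ) = 0 := by rw [dotProduct_self_crayaInt]; simp
  simp_rw [crayaVec_apply, mul_left_comm _ ((((crayaLen a k)⁻¹ : ℝ) : ℂ)), ← Finset.mul_sum]
  rw [dotProduct] at h
  push_cast at h
  rw [h, mul_zero]

/-- `⟪e_a(k), k⟫ = 0` (the frame is orthogonal to the frequency vector). -/
theorem inner_crayaVec_freqVec (a : Fin 2) (k : Fin 3 → ℤ) : ⟪crayaVec a k, Torus.freqVec k⟫_ℂ = 0 := by
  rw [inner_crayaVec_left]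
  have h : ((crayaInt a k ⬝ᵥ k : ℤ) : ℂ) = 0 := by
    rw [dotProduct_comm, dotProduct_self_crayaInt]; simp
  rw [dotProduct] at h
  push_cast at h
  simp_rw [Torus.freqVec_apply]
  rw [h, mul_zero]

/-- **Orthonormality** of the frame for `k ≠ 0`: `⟪e_a(k), e_b(k)⟫ = δ_ab`. -/
theorem inner_crayaVec_crayaVec {k : Fin 3 → ℤ} (hk : k ≠ 0) (a b : Fin 2) :
    ⟪crayaVec a k, crayaVec b k⟫_ℂ = if a = b then 1 else 0 := by
  rw [inner_crayaVec_left]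
  simp_rw [crayaVec_apply, mul_left_comm _ ((((crayaLen b k)⁻¹ : ℝ) : ℂ)), ← Finset.mul_sum]
  have hab : ∑ j, ((crayaInt a k j : ℤ) : ℂ) * ((crayaInt b k j : ℤ) : ℂ) =
      ((crayaInt a k ⬝ᵥ crayaInt b k : ℤ) : ℂ) := by
    rw [dotProduct]; push_cast; rfl
  rw [hab]
  by_cases h : a = b
  · subst h
    rw [if_pos rfl, ← mul_assoc, ← Complex.ofReal_mul, ← mul_inv, ← sq, crayaLen_sq,
      freqNormSq_eq_cast_dotProduct]
    have hne : ((crayaInt a k ⬝ᵥ crayaInt a k : ℤ) : ℂ) ≠ 0 := by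
      exact_mod_cast (dotProduct_crayaInt_self_pos hk a).ne'
    push_cast
    exact inv_mul_cancel₀ hne
  · rw [if_neg h]
    have h0 : crayaInt a k ⬝ᵥ crayaInt b k = 0 := by
      fin_cases a <;> fin_cases b
      · exact absurd rfl h
      · exact dotProduct_crayaInt_zero_one k
      · rw [dotProduct_comm]; exact dotProduct_crayaInt_zero_one k
      · exact absurd rfl h
    rw [h0]; simp

/-- The frame of a non-zero frequency is an orthonormal family. -/
theorem orthonormal_crayaVec {k : Fin 3 → ℤ} (hk : k ≠ 0) : Orthonormal ℂ (fun a => crayaVec a k) :=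
  orthonormal_iff_ite.mpr (inner_crayaVec_crayaVec hk)

/-- `‖e_a(k)‖ = 1` for `k ≠ 0`. -/
theorem norm_crayaVec {k : Fin 3 → ℤ} (hk : k ≠ 0) (a : Fin 2) : ‖crayaVec a k‖ = 1 :=
  (orthonormal_crayaVec hk).norm_eq_one a

/-- Casting commutes with the cross product (`ℤ³ → ℂ³`). -/
theorem cast_crossProduct (u v : Fin 3 → ℤ) :
    (fun j => (((u ⨯₃ v) j : ℤ) : ℂ)) = (fun j => ((u j : ℤ) : ℂ)) ⨯₃ (fun j => ((v j : ℤ) : ℂ)) := by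
  funext j
  fin_cases j <;> simp [cross_apply]

/-- **Completeness of the frame in `k^⊥`**: a vector of `ℂ³` orthogonal (bilinearly) to `k`, `E₁(k)`
and `E₂(k)`, `k ≠ 0`, vanishes (`E₂ = k × E₁`; `u × (u × w) = (u·w)u − |u|²w`). -/
theorem eq_zero_of_kdot_eq_zero_of_orthogonal {k : Fin 3 → ℤ} (hk : k ≠ 0) {w : EuclideanSpace ℂ (Fin 3)}
    (hw : ∑ j, ((k j : ℤ) : ℂ) * w j = 0)
    (h0 : ∑ j, ((crayaInt 0 k j : ℤ) : ℂ) * w j = 0)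
    (h1 : ∑ j, ((crayaInt 1 k j : ℤ) : ℂ) * w j = 0) : w = 0 := by
  set kc : Fin 3 → ℂ := fun j => ((k j : ℤ) : ℂ) with hkc
  set e1 : Fin 3 → ℂ := fun j => ((crayaInt 0 k j : ℤ) : ℂ) with he1
  set u : Fin 3 → ℂ := fun j => ((crayaInt 1 k j : ℤ) : ℂ) with hu
  set w' : Fin 3 → ℂ := WithLp.ofLp w with hw'
  have hkw : kc ⬝ᵥ w' = 0 := by simpa [dotProduct, hkc, hw'] using hw
  have he1w : e1 ⬝ᵥ w' = 0 := by simpa [dotProduct, he1, hw'] using h0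
  have huw : u ⬝ᵥ w' = 0 := by simpa [dotProduct, hu, hw'] using h1
  have hu_eq : u = kc ⨯₃ e1 := by
    rw [hu, hkc, he1, ← cast_crossProduct, crayaInt_zero, ← crayaInt_one]
  -- `u × w' = (k·w') E₁ − (E₁·w') k = 0`
  have huw' : u ⨯₃ w' = 0 := by
    rw [hu_eq, cross_cross_eq_smul_sub_smul, hkw, he1w, zero_smul, zero_smul, sub_zero]
  -- `u × (u × w') = (u·w') u − (u·u) w'`
  have hkey : (u ⬝ᵥ u) • w' = 0 := by
    have h := cross_cross_eq_smul_sub_smul' u u w'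
    rw [huw', huw, zero_smul, zero_sub, map_zero] at h
    exact neg_eq_zero.mp h.symm
  have huu : u ⬝ᵥ u ≠ 0 := by
    have h : u ⬝ᵥ u = ((crayaInt 1 k ⬝ᵥ crayaInt 1 k : ℤ) : ℂ) := by
      rw [hu, dotProduct, dotProduct]; push_cast; rfl
    rw [h]
    exact_mod_cast (dotProduct_crayaInt_self_pos hk 1).ne'
  have hw0 : w' = 0 := by
    rcases smul_eq_zero.mp hkey with h | h
    · exact absurd h huu
    · exact h
  ext j
  have := congr_fun hw0 j
  simpa [hw'] using this

/-- Frame coefficients are read off by inner products: `⟪e_a(k), ∑_b c_b e_b(k)⟫ = c_a` (`k ≠ 0`). -/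
theorem inner_crayaVec_sum_smul {k : Fin 3 → ℤ} (hk : k ≠ 0) (a : Fin 2) (c : Fin 2 → ℂ) :
    ⟪crayaVec a k, ∑ b, c b • crayaVec b k⟫_ℂ = c a := by
  rw [Fin.sum_univ_two, inner_add_right, inner_smul_right, inner_smul_right,
    inner_crayaVec_crayaVec hk, inner_crayaVec_crayaVec hk]
  fin_cases a <;> simp

/-- `k · (∑_b c_b e_b(k)) = 0`. -/
theorem kdot_sum_smul_crayaVec (k : Fin 3 → ℤ) (c : Fin 2 → ℂ) :
    ∑ j, ((k j : ℤ) : ℂ) * (∑ b, c b • crayaVec b k) j = 0 := by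
  rw [Fin.sum_univ_two, kdot_add, kdot_smul, kdot_smul, kdot_crayaVec, kdot_crayaVec]
  simp

/-- **The Leray multiplier in frame coordinates.** For EVERY frequency `k` and every `X ∈ ℂ³`:
`Π_k X = ∑_a ⟪e_a(k), X⟫ e_a(k)` — for `k ≠ 0` this is the orthogonal projection onto
`k^⊥ = span(e₁(k), e₂(k))`, for `k = 0` both sides vanish (`Π_0 = 0`, `e_a(0) = 0`). -/
theorem lerayCoeff_eq_sum_inner_crayaVec (k : Fin 3 → ℤ) (X : EuclideanSpace ℂ (Fin 3)) :
    Torus.lerayCoeff k X = ∑ a, ⟪crayaVec a k, X⟫_ℂ • crayaVec a k := by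
  by_cases hk : k = 0
  · subst hk; simp [crayaVec_zero_freq]
  set v := Torus.lerayCoeff k X with hv
  -- `⟪e_a, v⟫ = ⟪e_a, X⟫`
  have hinner : ∀ a, ⟪crayaVec a k, v⟫_ℂ = ⟪crayaVec a k, X⟫_ℂ := by
    intro a
    have hsub := sub_lerayCoeff hk X
    rw [← hv] at hsub
    have : X = v + ((∑ jj : Fin 3, ((k jj : ℤ) : ℂ) * X jj) / ((freqNormSq k : ℝ) : ℂ)) • Torus.freqVec k := by
      rw [← hsub]; abel
    rw [this, inner_add_right, inner_smul_right, inner_crayaVec_freqVec, mul_zero, add_zero]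
  have hlen : ∀ a : Fin 2, (((crayaLen a k)⁻¹ : ℝ) : ℂ) ≠ 0 := fun a => by
    exact_mod_cast (inv_pos.mpr (crayaLen_pos hk a)).ne'
  -- the difference is (bilinearly) orthogonal to `E₁`, `E₂` and `k`, hence zero
  have hperp : ∀ a, ∑ j, ((crayaInt a k j : ℤ) : ℂ) *
      (v - ∑ b, ⟪crayaVec b k, X⟫_ℂ • crayaVec b k) j = 0 := by
    intro a
    have h : ⟪crayaVec a k, v - ∑ b, ⟪crayaVec b k, X⟫_ℂ • crayaVec b k⟫_ℂ = 0 := by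
      rw [inner_sub_right, hinner, inner_crayaVec_sum_smul hk, sub_self]
    rw [inner_crayaVec_left] at h
    exact (mul_eq_zero.mp h).resolve_left (hlen a)
  have hkw : ∑ j, ((k j : ℤ) : ℂ) * (v - ∑ b, ⟪crayaVec b k, X⟫_ℂ • crayaVec b k) j = 0 := by
    rw [kdot_sub', hv, kdot_lerayCoeff, kdot_sum_smul_crayaVec, sub_zero]
  exact sub_eq_zero.mp (eq_zero_of_kdot_eq_zero_of_orthogonal hk hkw (hperp 0) (hperp 1))

/-- A transversal vector is its own frame expansion: `k · X = 0`, `k ≠ 0` ⇒ `X = ∑_a ⟪e_a(k), X⟫ e_a(k)`. -/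
theorem eq_sum_inner_crayaVec_of_kdot_eq_zero {k : Fin 3 → ℤ} (hk : k ≠ 0) {X : EuclideanSpace ℂ (Fin 3)}
    (hX : ∑ j, ((k j : ℤ) : ℂ) * X j = 0) : X = ∑ a, ⟪crayaVec a k, X⟫_ℂ • crayaVec a k := by
  rw [← lerayCoeff_eq_sum_inner_crayaVec, lerayCoeff_of_kdot_eq_zero hk hX]

end Summit.NavierStokesRegularity.FluidComputer.CrayaFrames

end
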